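import Literature.Probability.RandomPlanarGeometry.SAWPulledLargeForceThirdOrder
import HarnessLib

/-!
# The memory-five transfer framework for the pulled walk on `ℤ²` (no reversal, no unit square, no 1×2 rectangle)

Topic `Literature/Probability/RandomPlanarGeometry` (continues `SAWPulledLargeForceThirdOrder.lean`, namespace `PullSq`, which treats
memory three = Madras–Slade's memory 4). The next finite-memory rule (memory 6 in the Madras–Slade count, `c_{N,6}`): a letter may be
appended to the five remembered letters iff it does not reverse the last one, closes no unit square with the last three and no hexagon
(a 1×2 rectangle — the only six-step closed loops of `ℤ²`) with the last five; equivalently, no window of 2, 4 or 6 consecutive letters has zero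
displacement. Every self-avoiding word is admissible (`PullR6.adm5_of_isSAW`), five virtual up-steps make a weak-half-space word readable from
the straight memory (`PullR6.isSAW_up5_append`), and an excessive potential bounds Beaton's `U_n(y)` (`PullR6.pulledU_le_of_potential5`, with a
floor `u ≥ δ`). This is the infrastructure for the two-sided FIFTH-order large-force law (the rule is exact through `y⁻⁶`: its Perron root reads
`y + 2 − 2/y + 6/y² − 20/y³ + 74/y⁴ − 284/y⁵ + 1100/y⁶ − 4174/y⁷…`, against the true `−4188/y⁷`); the 284-memory eigenvector certificate itself is
not in this file.

References: Madras–Slade 1993 §1.2 (1.2.12)–(1.2.14) (finite-memory walks `c_{N,τ} ≥ c_N`); Beaton 2015 §2 (`U_n(y)`). (Lane «pcv-sawmu», a-p3 g13.)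
-/

noncomputable section

open Finset Literature.Probability.LatticeModels
open Literature.Probability.RandomPlanarGeometry.SAW

namespace Literature.Probability.RandomPlanarGeometry.SAW.Zd

namespace PullR6

open PullSq

/-- A hexagon window: six consecutive letters whose displacements cancel (on `ℤ²`: a 1×2 rectangle). [cite: MadrasSlade1993, §1.2, eq. (1.2.12)–(1.2.14)] -/
def IsHex (a b c d e f : Step) : Prop :=
  Step.dx a + Step.dx b + Step.dx c + Step.dx d + Step.dx e + Step.dx f = 0 ∧
    Step.dy a + Step.dy b + Step.dy c + Step.dy d + Step.dy e + Step.dy f = 0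

/-- `IsHex` is decidable. [folklore] -/
instance (a b c d e f : Step) : Decidable (IsHex a b c d e f) := by unfold IsHex; infer_instance

/-- The memory-five rule: the remembered letters `a b c d e` contain no reversal and no unit square, the new letter `s` does not reverse `e`,
`c d e s` is not a unit square and `a b c d e s` is not a hexagon. [cite: MadrasSlade1993, §1.2, eq. (1.2.12)–(1.2.14)] -/
def Allowed5 (a b c d e s : Step) : Prop :=
  b ≠ Step.opp a ∧ c ≠ Step.opp b ∧ d ≠ Step.opp c ∧ e ≠ Step.opp d ∧ s ≠ Step.opp e ∧
    ¬ PullSq.IsSquare a b c d ∧ ¬ PullSq.IsSquare b c d e ∧ ¬ PullSq.IsSquare c d e s ∧ ¬ IsHex a b c d e s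

/-- `Allowed5` is decidable. [folklore] -/
instance (a b c d e s : Step) : Decidable (Allowed5 a b c d e s) := by unfold Allowed5; infer_instance

/-- Admissible words read from the memory `(a, b, c, d, e)`. [cite: MadrasSlade1993, §1.2, eq. (1.2.12)–(1.2.14)] -/
def Adm5 : Step → Step → Step → Step → Step → List Step → Prop
  | _, _, _, _, _, [] => True
  | a, b, c, d, e, s :: w => Allowed5 a b c d e s ∧ Adm5 b c d e s w

/-- `Adm5` is decidable. [folklore] -/
instance decAdm5 : ∀ (a b c d e : Step) (w : List Step), Decidable (Adm5 a b c d e w)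
  | _, _, _, _, _, [] => isTrue trivial
  | a, b, c, d, e, s :: w =>
    haveI := decAdm5 b c d e s w
    inferInstanceAs (Decidable (Allowed5 a b c d e s ∧ Adm5 b c d e s w))

/-- Tilted potential-weighted value of a word read from a five-letter memory. [folklore] -/
def pval5 (u : Step → Step → Step → Step → Step → ℝ) (y : ℝ) : Step → Step → Step → Step → Step → List Step → ℝ
  | a, b, c, d, e, [] => u a b c d e
  | _, b, c, d, e, s :: w => swt y s * pval5 u y b c d e s w

/-- `pval5` restricted to admissible words. [folklore] -/
def pF5 (u : Step → Step → Step → Step → Step → ℝ) (y : ℝ) (a b c d e : Step) (w : List Step) : ℝ :=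
  if Adm5 a b c d e w then pval5 u y a b c d e w else 0

/-- The one-step tilted potential sum of the memory-five rule. [folklore] -/
def plocSum5 (u : Step → Step → Step → Step → Step → ℝ) (y : ℝ) (a b c d e : Step) : ℝ :=
  ∑ s : Step, if Allowed5 a b c d e s then swt y s * u b c d e s else 0

/-- `swt > 0`. [folklore] -/
private theorem swt_pos' {y : ℝ} (hy : 0 < y) (s : Step) : 0 < swt y s := zpow_pos hy _

/-- `pval5 ≥ 0`. [folklore] -/
private theorem pval5_nonneg {u : Step → Step → Step → Step → Step → ℝ} (hu : ∀ a b c d e, 0 ≤ u a b c d e) {y : ℝ} (hy : 0 < y) :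
    ∀ (w : List Step) (a b c d e : Step), 0 ≤ pval5 u y a b c d e w
  | [], a, b, c, d, e => hu a b c d e
  | s :: w, _, b, c, d, e => mul_nonneg (swt_pos' hy s).le (pval5_nonneg hu hy w b c d e s)

/-- `pF5 ≥ 0`. [folklore] -/
private theorem pF5_nonneg {u : Step → Step → Step → Step → Step → ℝ} (hu : ∀ a b c d e, 0 ≤ u a b c d e) {y : ℝ} (hy : 0 < y)
    (a b c d e : Step) (w : List Step) : 0 ≤ pF5 u y a b c d e w := by
  unfold pF5; split_ifs
  · exact pval5_nonneg hu hy w a b c d e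
  · exact le_rfl

/-- Peeling the first letter of `pF5`. [folklore] -/
private theorem pF5_cons (u : Step → Step → Step → Step → Step → ℝ) (y : ℝ) (a b c d e s : Step) (w : List Step) :
    pF5 u y a b c d e (s :: w) = (if Allowed5 a b c d e s then swt y s else 0) * pF5 u y b c d e s w := by
  unfold pF5
  simp only [Adm5, pval5]
  by_cases h1 : Allowed5 a b c d e s
  · by_cases h2 : Adm5 b c d e s w
    · simp [h1, h2]
    · simp [h1, h2]
  · simp [h1]

/-- Words of length `n + 1` are `s :: w` with `|w| = n`. [folklore] -/
private theorem words_succ_eq'' (n : ℕ) :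
    words (n + 1) = (Finset.univ ×ˢ words n).image (fun p : Step × List Step => p.1 :: p.2) := by
  ext w
  simp only [mem_words, Finset.mem_image, Finset.mem_product, Finset.mem_univ, true_and]
  constructor
  · intro h
    cases w with
    | nil => simp at h
    | cons s v => exact ⟨(s, v), by simpa using h, rfl⟩
  · rintro ⟨⟨s, v⟩, hv, rfl⟩
    simpa using hv

/-- **The excessive-potential bound** for the memory-five rule: `Σ_{|w| = m} pF5 ≤ Λ^m u`. [cite: MadrasSlade1993, §1.2, eq. (1.2.12)–(1.2.14)] -/
theorem psum_words_le5 {u : Step → Step → Step → Step → Step → ℝ} {y Λ : ℝ} (hy : 0 < y) (hΛ : 0 ≤ Λ)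
    (hloc : ∀ a b c d e, plocSum5 u y a b c d e ≤ Λ * u a b c d e) :
    ∀ (m : ℕ) (a b c d e : Step), ∑ w ∈ words m, pF5 u y a b c d e w ≤ Λ ^ m * u a b c d e := by
  classical
  intro m
  induction m with
  | zero =>
    intro a b c d e
    have h0 : words 0 = {[]} := by
      ext w; simp only [mem_words, Finset.mem_singleton, List.length_eq_zero_iff]
    simp [h0, pF5, Adm5, pval5]
  | succ m ih =>
    intro a b c d e
    rw [words_succ_eq'', Finset.sum_image, Finset.sum_product]
    · calc ∑ s : Step, ∑ w ∈ words m, pF5 u y a b c d e (s :: w)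
            = ∑ s : Step, (if Allowed5 a b c d e s then swt y s else 0) * ∑ w ∈ words m, pF5 u y b c d e s w := by
              refine Finset.sum_congr rfl fun s _ => ?_
              rw [Finset.mul_sum]
              refine Finset.sum_congr rfl fun w _ => ?_
              rw [pF5_cons]
        _ ≤ ∑ s : Step, (if Allowed5 a b c d e s then swt y s else 0) * (Λ ^ m * u b c d e s) := by
              refine Finset.sum_le_sum fun s _ => ?_
              by_cases hs : Allowed5 a b c d e s
              · rw [if_pos hs]
                exact mul_le_mul_of_nonneg_left (ih b c d e s) (swt_pos' hy s).le
              · rw [if_neg hs, zero_mul, zero_mul]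
        _ = Λ ^ m * plocSum5 u y a b c d e := by
              rw [plocSum5, Finset.mul_sum]
              refine Finset.sum_congr rfl fun s _ => ?_
              split_ifs <;> ring
        _ ≤ Λ ^ m * (Λ * u a b c d e) := mul_le_mul_of_nonneg_left (hloc a b c d e) (pow_nonneg hΛ m)
        _ = Λ ^ (m + 1) * u a b c d e := by ring
    · rintro ⟨s, w⟩ _ ⟨s', w'⟩ _ hp
      simp only [List.cons.injEq] at hp
      exact Prod.ext hp.1 hp.2

/-- The memory after reading `w`. [folklore] -/
def last5 : Step → Step → Step → Step → Step → List Step → Step × Step × Step × Step × Step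
  | a, b, c, d, e, [] => (a, b, c, d, e)
  | _, b, c, d, e, s :: w => last5 b c d e s w

/-- `pval5 = y^{height gained} · u(final memory)`. [folklore] -/
private theorem pval5_eq (u : Step → Step → Step → Step → Step → ℝ) {y : ℝ} (hy : y ≠ 0) :
    ∀ (w : List Step) (a b c d e : Step),
      pval5 u y a b c d e w = y ^ (wEnd w 0) *
        u (last5 a b c d e w).1 (last5 a b c d e w).2.1 (last5 a b c d e w).2.2.1 (last5 a b c d e w).2.2.2.1
          (last5 a b c d e w).2.2.2.2
  | [], a, b, c, d, e => by simp [pval5, last5]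
  | s :: w, a, b, c, d, e => by
    rw [pval5, pval5_eq u hy w, last5, wEnd_cons, Pi.add_apply, Step.vec_apply_zero, zpow_add₀ hy, swt]
    ring

/-- `traj (s :: w) (i+1) = vec s + traj w i`. [folklore] -/
private theorem traj_cons_succ'' (s : Step) (w : List Step) (i : ℕ) : traj (s :: w) (i + 1) = Step.vec s + traj w i := by
  simp only [traj, List.take_succ_cons, wEnd_cons]

/-- A hexagon window closes up. [folklore] -/
private theorem vec_sum_eq_zero_of_isHex {a b c d e f : Step} (h : IsHex a b c d e f) :
    Step.vec a + Step.vec b + Step.vec c + Step.vec d + Step.vec e + Step.vec f = 0 := by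
  ext i
  fin_cases i
  · simpa [Step.vec] using h.1
  · simpa [Step.vec] using h.2

/-- In a self-avoiding word no six consecutive letters form a hexagon. [folklore] -/
private theorem not_isHex_of_isSAW {a b c d e f : Step} {w : List Step} (h : IsSAW (a :: b :: c :: d :: e :: f :: w)) :
    ¬ IsHex a b c d e f := by
  intro hx
  have hinj := (isSAW_iff_injOn _).1 h
  have h06 : traj (a :: b :: c :: d :: e :: f :: w) 0 = traj (a :: b :: c :: d :: e :: f :: w) 6 := by
    rw [traj_zero, traj_cons_succ'', traj_cons_succ'', traj_cons_succ'', traj_cons_succ'', traj_cons_succ'', traj_cons_succ'',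
      traj_zero, add_zero]
    have := vec_sum_eq_zero_of_isHex hx
    rw [← add_assoc, ← add_assoc, ← add_assoc, ← add_assoc, this]
  have := hinj (by simp) (by simp) h06
  exact absurd this (by norm_num)

/-- **A self-avoiding word is admissible for the memory-five rule** (read after its own first five letters). [cite: MadrasSlade1993, §1.2, eq. (1.2.12)–(1.2.14)] -/
theorem adm5_of_isSAW : ∀ (w : List Step) (a b c d e : Step), IsSAW (a :: b :: c :: d :: e :: w) → Adm5 a b c d e w
  | [], _, _, _, _, _, _ => trivial
  | s :: w, a, b, c, d, e, h => by
    have h3 : Adm3 a b c (d :: e :: s :: w) := adm3_of_isSAW _ a b c h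
    obtain ⟨⟨hba, hcb, hdc, hsq1⟩, ⟨_, _, hed, hsq2⟩, ⟨_, _, hse, hsq3⟩, -⟩ := h3
    exact ⟨⟨hba, hcb, hdc, hed, hse, hsq1, hsq2, hsq3, not_isHex_of_isSAW h⟩, adm5_of_isSAW w b c d e s (h.drop 1)⟩

/-- **Five virtual up-steps**: if `w` is self-avoiding and stays in `x ≥ 0`, then `[+e₀]⁵ ++ w` is self-avoiding. [cite: Beaton2015, §2 (pp. 2–3: walks in the half-space)] -/
theorem isSAW_up5_append {w : List Step} (hs : IsSAW w) (hx : ∀ i ≤ w.length, 0 ≤ traj w i 0) :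
    IsSAW ([(0 : Step), 0, 0, 0, 0] ++ w) := by
  have h3 : IsSAW ([(0 : Step), 0, 0] ++ w) := isSAW_up3_append hs hx
  have hx3 : ∀ i ≤ ([(0 : Step), 0, 0] ++ w).length, 0 ≤ traj ([(0 : Step), 0, 0] ++ w) i 0 := by
    set u : List Step := [0, 0, 0] with hu
    have hul : u.length = 3 := by simp [hu]
    intro i hi
    rcases lt_or_ge i 3 with h | h
    · rw [traj_append_left u w (by rw [hul]; omega)]
      interval_cases i <;> simp [hu, traj, wEnd, Step.vec, Step.dx]
    · obtain ⟨k, rfl⟩ : ∃ k, i = 3 + k := ⟨i - 3, by omega⟩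
      have hk : k ≤ w.length := by rw [List.length_append, hul] at hi; omega
      have hr := traj_append_right u w k
      rw [hul] at hr
      rw [hr, Pi.add_apply]
      have h0 : (0 : ℤ) ≤ wEnd u 0 := by simp [hu, wEnd, Step.vec, Step.dx]
      linarith [hx k hk]
  have h6 := isSAW_up3_append h3 hx3
  have e : [(0 : Step), 0, 0] ++ ([(0 : Step), 0, 0] ++ w) = (0 : Step) :: ([(0 : Step), 0, 0, 0, 0] ++ w) := by simp
  rw [e] at h6
  simpa using h6.drop 1

/-- **`U_n(y) ≤ Λⁿ u(+e₀,…,+e₀)/δ`** for every `Λ`-excessive memory-five potential `u ≥ δ > 0` (`y > 0`). [cite: Beaton2015, §2 (pp. 2–3: U_n(y))] -/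
theorem pulledU_le_of_potential5 (u : Step → Step → Step → Step → Step → ℝ) {y Λ δ : ℝ} (hy : 0 < y) (hΛ : 0 ≤ Λ) (hδ : 0 < δ)
    (hu : ∀ a b c d e, δ ≤ u a b c d e) (hloc : ∀ a b c d e, plocSum5 u y a b c d e ≤ Λ * u a b c d e) (n : ℕ) :
    pulledU 2 n y ≤ Λ ^ n * u 0 0 0 0 0 / δ := by
  classical
  have hu0 : ∀ a b c d e, 0 ≤ u a b c d e := fun a b c d e => hδ.le.trans (hu a b c d e)
  set good : Finset (List Step) := (sawWords n).filter (fun w => ∀ i ≤ n, 0 ≤ traj w i 0) with hgood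
  have himage : weakHalfSpaceWalks 2 n = good.image traj := by
    ext ω
    simp only [mem_weakHalfSpaceWalks, Finset.mem_image, hgood, Finset.mem_filter, mem_sawWords]
    constructor
    · rintro ⟨hω, hhp⟩
      have hω' : ω ∈ (sawWords n).image traj := by rw [image_traj_sawWords]; exact hω
      obtain ⟨w, hw, rfl⟩ := Finset.mem_image.1 hω'
      exact ⟨w, ⟨mem_sawWords.1 hw, hhp⟩, rfl⟩
    · rintro ⟨w, ⟨⟨hl, hs⟩, hhp⟩, rfl⟩
      exact ⟨traj_mem_saws hl hs, hhp⟩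
  have hmem : ∀ w ∈ good, (w.length = n ∧ IsSAW w) ∧ ∀ i ≤ n, 0 ≤ traj w i 0 := fun w hw => by
    simpa [hgood] using hw
  have hinj : Set.InjOn traj (good : Set (List Step)) := fun w hw w' hw' h =>
    traj_injOn n (by simp [(hmem w hw).1.1]) (by simp [(hmem w' hw').1.1]) h
  rw [pulledU, himage, Finset.sum_image hinj]
  have hterm : ∀ w ∈ good, y ^ (traj w n 0).toNat ≤ pF5 u y 0 0 0 0 0 w / δ := by
    intro w hw
    obtain ⟨⟨hl, hs⟩, hhp⟩ := hmem w hw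
    have hsaw5 : IsSAW ((0 : Step) :: 0 :: 0 :: 0 :: 0 :: w) := by
      simpa using isSAW_up5_append hs (by rw [hl]; exact hhp)
    have hadm : Adm5 0 0 0 0 0 w := adm5_of_isSAW w 0 0 0 0 0 hsaw5
    have hend : 0 ≤ wEnd w 0 := by
      have := hhp n le_rfl
      rwa [← hl, traj_length] at this
    have htn : traj w n 0 = wEnd w 0 := by rw [← hl, traj_length]
    rw [pF5, if_pos hadm, pval5_eq u hy.ne', le_div_iff₀ hδ, htn]
    have hz : y ^ (wEnd w 0).toNat = y ^ (wEnd w 0) := by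
      rw [← zpow_natCast, Int.toNat_of_nonneg hend]
    rw [hz]
    exact mul_le_mul_of_nonneg_left (hu _ _ _ _ _) (zpow_pos hy _).le
  have hsub : good ⊆ words n := fun w hw => mem_words.2 (hmem w hw).1.1
  calc ∑ w ∈ good, y ^ (traj w n 0).toNat ≤ ∑ w ∈ good, pF5 u y 0 0 0 0 0 w / δ := Finset.sum_le_sum hterm
    _ ≤ ∑ w ∈ words n, pF5 u y 0 0 0 0 0 w / δ :=
        Finset.sum_le_sum_of_subset_of_nonneg hsub fun w _ _ => div_nonneg (pF5_nonneg hu0 hy _ _ _ _ _ _) hδ.le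
    _ = (∑ w ∈ words n, pF5 u y 0 0 0 0 0 w) / δ := by rw [Finset.sum_div]
    _ ≤ Λ ^ n * u 0 0 0 0 0 / δ := by
        gcongr
        exact psum_words_le5 hy hΛ hloc n 0 0 0 0 0

end PullR6

end Literature.Probability.RandomPlanarGeometry.SAW.Zd
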